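import Summits.ResolutionOfSingularities.ResolutionOfSingularities.Theorems.HilbertSamuelEliminationSigmaMaxModificationsCorridor3WLadderGradeZero
import Literature.AlgebraicGeometry.Resolution.RegularLocalRingsUFD
import Mathlib.RingTheory.KrullDimension.Zero
import HarnessLib

/-!
# [OURS · L1 W4.2] The canonical centre at a BLOWN-UP marked point: `dim_{x_n} C < e_{x_n}` (CJS Thm. 3.14), and
# `C_{x_n} = 𝔪_{x_n}` when `e ≤ 1` — local step data for grade 1 / the units-half of `stub_Wlow3M_char`
# (crux chain w42, line `w_ladder`; `--supports stmt-ResolutionOfSingularities-19249`, helper)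

OURS (cell res-hironaka, slot W4.2, seat res-L1-w42-stub-2 gen 3); NOT statements of H. Hironaka's manuscript
[Hironaka2017]. AI-drafted, weaker than expert review. Sorry-free PROOF file (no new definition), continuing
`…Corridor3WLadderGradeZero.lean`: the chain-level reading of the binder of record `CossartJannsenSaito2020_thm_3_14`
(CJS Thm. 3.14 in the numeric form «`dim 𝒪_{D,x} < e_x(X)` at a near point», p499700) at a GOOD stage of `S(X, ν)` whose
marked point `x_n` is blown up with a next marked point above it:

* `Moving.centreDim_lt_dirDim_of_isBlownUp` — for THE canonical centre `C ∋ x_n`: `dim (𝒪_{X_n,x_n}/C_{x_n}) < e_{x_n}(X_n)`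
  (the next marked point is near; `C` is permissible at a good state; (F1) at `x_n`).
* `Moving.stalkIdeal_centre_eq_maximalIdeal_of_dirDim_le_one` — if moreover `e_{x_n}(X_n) ≤ 1` then `C_{x_n} = 𝔪_{x_n}`:
  LOCALLY AT THE MARKED POINT THE GENUINE STEP IS THE BLOW-UP OF THE CLOSED POINT (the regular local ring
  `𝒪_{X_n,x_n}/C_{x_n}` has dimension `0`, hence is a field). This is the entry point of the grade-`1` units argument
  (CJS Cor. 6.37: the fundamental sequence at an isolated point with `e = 1` «consists of a sequence of blow-ups in
  closed points and is finite») and of Def. 6.38 (ii) («`X_1 = Bℓ_x(X)`») for the units at `e = 2` when the centre is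
  zero-dimensional at `x_n`.
* `Moving.stalkIdeal_centre_eq_maximalIdeal_of_reaches` — the same packaged along `Reaches` from a maximal origin in the
  (F1) regime `QCharRegime p` (`ν ≠ Φ^{(3)}`; for `ν = Φ^{(3)}` no marked point with `e ≤ 1`… is ever blown up unless
  `dim 𝒪 ≤ 1`, not needed here).

## References

* V. Cossart, U. Jannsen, S. Saito, LNM 2270 (2020): Def. 3.1, Thm. 3.14, Lemma 3.15, Def. 6.34, Cor. 6.37, Def. 6.38 (ii).
  [CossartJannsenSaito2020]
-/

noncomputable section

-- namespace `…Corridor3.Moving` re-enters `…Corridor3` (module convention of the Moving files)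
set_option linter.dupNamespace false

open CategoryTheory AlgebraicGeometry TopologicalSpace IsLocalRing
open Literature.AlgebraicGeometry.Resolution Literature.RingTheory.HilbertSamuel

universe u

open Summit.ResolutionOfSingularities.ResolutionOfSingularities.Theorems.CampaignW42
open Literature.AlgebraicGeometry.CossartJannsenSaito2020
open Summit.ResolutionOfSingularities.ResolutionOfSingularities.Theorems.SigmaMaxModificationsCorridor3

namespace Summit.ResolutionOfSingularities.ResolutionOfSingularities.Theorems.SigmaMaxModificationsCorridor3.Moving

variable {R : ∀ S : Scheme.{u}, CentreSeq S → Prop} {N : ℕ} {ν : ℕ → ℕ}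

/-! ## A regular local ring of dimension `< 1` is a field -/

/-- An ideal `I` of a local ring `A` with `A/I` a regular local ring of Krull dimension `< 1` is the maximal ideal
(`A/I` is a domain of dimension `0`, hence a field). [folklore] -/
theorem _root_.Ideal.eq_maximalIdeal_of_isRegularLocalRing_quotient_of_ringKrullDim_lt_one {A : Type u} [CommRing A]
    [IsLocalRing A] {I : Ideal A} (hreg : IsRegularLocalRing (A ⧸ I))
    (hdim : ringKrullDim (A ⧸ I) < ((1 : ℕ) : WithBot ℕ∞)) : I = maximalIdeal A := by
  haveI := hreg
  haveI : IsDomain (A ⧸ I) := isDomain_of_isRegularLocalRing (A ⧸ I)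
  obtain ⟨d, hd⟩ := exists_nat_eq_of_ne_bot_of_ne_top (ringKrullDim_ne_bot (R := A ⧸ I)) ringKrullDim_ne_top
  have hd0 : d = 0 := by
    rw [hd] at hdim
    have : d < 1 := by exact_mod_cast hdim
    omega
  haveI : Ring.KrullDimLE 0 (A ⧸ I) := by
    rw [Ring.krullDimLE_iff, hd, hd0]
  have hF : IsField (A ⧸ I) := Ring.KrullDimLE.isField_of_isDomain
  exact IsLocalRing.eq_maximalIdeal (Ideal.Quotient.maximal_of_isField I hF)

/-! ## The canonical centre at a blown-up marked point of a good stage -/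

/-- **`dim_{x_n} C < e_{x_n}(X_n)` for THE canonical centre through a blown-up marked point** (modulo
`CossartJannsenSaito2020_thm_3_14`): at a GOOD stage whose marked point `x_n` lies in the `ν`-stratum and satisfies (F1),
if the canonical step has centre `C ∋ x_n` and a next marked point `x_{n+1}` exists above `x_n` (a canonical near step
`s → s'`), then `dim (𝒪_{X_n,x_n}/C_{x_n}) < e_{x_n}(X_n)` — `x_{n+1}` is NEAR, `C` is permissible.
[cite: CossartJannsenSaito2020, Thm. 3.14] -/
theorem centreDim_lt_dirDim_of_isBlownUp (h314 : CossartJannsenSaito2020_thm_3_14.{u}) (hRf : OracleFunctional R)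
    {k : Type u} [Field k] {s s' : MarkedStage.{u}} (hg : StateGood k R N ν s.W s.L s.P)
    (hpt : s.pt ∈ Scheme.hsStratum s.W N ν) (hst : CanonicalNearStep R N ν s s') (hchar : CharHypothesis s.W s.pt)
    {C : s.W.IdealSheafData} {P' : Option (Pending (blowup C))} (hcs : IsCanonicalStep R N ν s.L s.P C P')
    (hmem : s.pt ∈ (C.support : Set s.W)) :
    ringKrullDim (s.W.presheaf.stalk s.pt ⧸ stalkIdeal C s.pt) < (dirDim s : WithBot ℕ∞) := by
  haveI : IsLocallyNoetherian s.W := s.ln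
  obtain ⟨C₂, P₂', hln, x', hcs₂, hπ, -, hx', -⟩ := hst
  obtain rfl : C = C₂ := IsCanonicalStep.centre_unique hRf hcs hcs₂
  haveI : IsLocallyNoetherian (blowup C) := hln
  have hnear : Scheme.hsFun (blowup C) N x' = Scheme.hsFun s.W N ((blowup.π C).base x') := by
    rw [hπ, Scheme.mem_hsStratum_iff.mp hx', Scheme.mem_hsStratum_iff.mp hpt]
  have key := h314 s.W (blowup C) (blowup.π C) C hg.isExcellent (hg.isPermissible hcs) (blowup.isBlowup C) N
    hg.dim_le x' (hπ ▸ hmem) (hπ ▸ hchar) hnear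
  rw [hπ] at key
  exact key

/-- **`C_{x_n} = 𝔪_{x_n}` when `e_{x_n} ≤ 1`**: under the hypotheses of `centreDim_lt_dirDim_of_isBlownUp` and
`e_{x_n}(X_n) ≤ 1`, the stalk of THE canonical centre at the marked point is the maximal ideal — locally at `x_n` the
genuine step is the blow-up of the closed point (`𝒪_{X_n,x_n}/C_{x_n}` is a regular local ring of dimension `0`).
[cite: CossartJannsenSaito2020, Thm. 3.14, Cor. 6.37, Def. 6.38 (ii)] -/
theorem stalkIdeal_centre_eq_maximalIdeal_of_dirDim_le_one (h314 : CossartJannsenSaito2020_thm_3_14.{u})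
    (hRf : OracleFunctional R) {k : Type u} [Field k] {s s' : MarkedStage.{u}} (hg : StateGood k R N ν s.W s.L s.P)
    (hpt : s.pt ∈ Scheme.hsStratum s.W N ν) (hst : CanonicalNearStep R N ν s s') (hchar : CharHypothesis s.W s.pt)
    (he : dirDim s ≤ 1) {C : s.W.IdealSheafData} {P' : Option (Pending (blowup C))}
    (hcs : IsCanonicalStep R N ν s.L s.P C P') (hmem : s.pt ∈ (C.support : Set s.W)) :
    stalkIdeal C s.pt = maximalIdeal (s.W.presheaf.stalk s.pt) := by
  haveI : IsLocallyNoetherian s.W := s.ln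
  have hlt := centreDim_lt_dirDim_of_isBlownUp h314 hRf hg hpt hst hchar hcs hmem
  have hperm : (stalkIdeal C s.pt).IsPermissible := hg.isPermissible hcs s.pt hmem
  refine Ideal.eq_maximalIdeal_of_isRegularLocalRing_quotient_of_ringKrullDim_lt_one hperm.isRegularLocalRing ?_
  exact hlt.trans_le (by exact_mod_cast he)

/-- **Along a chain from a maximal origin in the (F1) regime (`ν ≠ Φ^{(3)}`): at a blown-up stage with `e ≤ 1` that has a
next marked point, THE canonical centre is the maximal ideal at the marked point** (good states from
`stateGood_init_general`, (F1) from `charHypothesis_of_qCharRegime`). [cite: CossartJannsenSaito2020, Thm. 3.14, Cor. 6.37] -/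
theorem stalkIdeal_centre_eq_maximalIdeal_of_reaches (h314 : CossartJannsenSaito2020_thm_3_14.{u})
    (hRf : OracleFunctional R) (hRa : OracleAdmissible R) {p : ℕ} {X : Scheme.{u}} [IsLocallyNoetherian X] {x : X}
    (hX : IsMaximalOrigin p 3 ν X x) (hq : Helpers.QCharRegime p 3 ν X x) (hν : ν ≠ iterPSum 3 Phi)
    {s s' : MarkedStage.{u}} (hreach : Reaches R 3 ν (MarkedStage.init X x) s) (hst : CanonicalNearStep R 3 ν s s')
    (he : dirDim s ≤ 1) {C : s.W.IdealSheafData} {P' : Option (Pending (blowup C))}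
    (hcs : IsCanonicalStep R 3 ν s.L s.P C P') (hmem : s.pt ∈ (C.support : Set s.W)) :
    stalkIdeal C s.pt = maximalIdeal (s.W.presheaf.stalk s.pt) := by
  obtain ⟨k, _, _, f, -, hft, hqc⟩ := hX.exists_structure
  haveI := hft
  haveI := hqc
  haveI := hX.isReduced
  have hgood : StateGood k R 3 ν s.W s.L s.P :=
    stateGood_of_reaches (stateGood_init_general hRa f hX.dim_le hX.maximal hν) hreach
  exact stalkIdeal_centre_eq_maximalIdeal_of_dirDim_le_one h314 hRf hgood
    (pt_mem_hsStratum_of_reaches hX.mem_stratum hreach) hst (charHypothesis_of_qCharRegime hX hq hreach hgood) he hcs hmem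

end Summit.ResolutionOfSingularities.ResolutionOfSingularities.Theorems.SigmaMaxModificationsCorridor3.Moving

end
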